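import Summits.Ventures.AbcShadow.SH04.PairRowK
import Summits.Ventures.AbcShadow.SH04.KrausAux67
import Summits.Ventures.AbcShadow.SH04.Level87
import Summits.Ventures.AbcShadow.SH04.Level261
import Summits.Ventures.AbcShadow.SH04.Level783
import Summits.Ventures.AbcSig.Conjectures.KrausTableSymmetry

/-!
# Venture AbcShadow — ROW SH-04 `(29, 11)` of [BVY04, Thm 1.6] on the package AS AMENDED (two-signed) + the KRAUS AUXILIARY PRIME 67:
# `x¹¹ + 29^α y¹¹ = z³` — a CONDITIONAL STRIKE

HONEST FRAMING. A row of the work-bound cell `abc-shadow` (typer seat `abc-shadow-typ-1`, lineage g6; director summon rq217 / g14-D7, KEY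
`KEY-abc-shadow-typ-1-SH04-2911B.md` 9194c00c07baefe5; door = inv-6 g9 `DOOR-OR-OBSTRUCTION-SH04-2911.md` 9a25b7c3dd9d37a8; verdict + BINDING
conditions C1–C6 = crit-1 g6 `crit-1-SH04-2911-D6.md` 075fd9b901ac09e8): a CONDITIONAL, typed/kernel-checked REDUCTION, no claim on abc or on any
summit, no side on IUT. `(C, p) = (29, 11)` [print's letters; here `(p, n) = (29, 11)`] is one of the ten possibly-exceptional pairs LISTED in
[BVY04, Thm 1.6, p. 1400] — OPEN IN PRINT (`11 ∤ 29² − 1 = 840`, so it is open only through the list; re-listed [RG24, Thm 4.38]); `sh04Pair29_11_listed`.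
WHY IT RESISTED (not print's words — the cell's reading): at `δ = 1` (level `87 = 3·29`) the orbit 87.1 at `λ = (11, y + 3)` carries a GENUINE
congruence with 174a1 (rational 3-torsion), so no [Prop 4.2] set `S_q` ever excludes it; likewise its `χ₋₃`-twist 261.3 ≅ 522m1[11] at `δ = 2`.
THE STRIKE (C2, verbatim in substance): «CLOSED-by-us — CONDITIONAL STRIKE — for `α ≢ 0 (mod 11)` the surviving pairs (87.1, λ) and (261.3, λ)
are excluded IDEAL-WISE at the Kraus auxiliary prime `q = 67 = 6·11 + 1` (`29³ ≡ 1 (mod 67)`; refined trace set `T₆₇ = {−16, −10, 5, 8, 11} ∌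
−4 ≡ c₆₇ (mod λ)`, level raising `±68 ≢ −4`); `δ = 3` (level 783) has no survivor; `α ≡ 0 (mod 11)` is [DM97] — modulo H1 [BCDT01], H2 [Rib90],
H3 [BVY04 L.2.1/L.3.1/Cor 3.3/L.3.4] as printed, H4 the trace congruences IDEAL-WISE and two-signed [KO92]/[Sik08 Prop 5.1] (= [Prop 4.2] read
ν-wise) + the Kraus auxiliary prime 67, H5 COMPUTED newform data of `S₂^new(87 / 261 / 783)` (certificate 4a36c28685fe0350; `c₆₇` of 87.1 /
261.3 by crit-1 PARI j326036; 783 inherited), H6 elementary 𝔽₆₇ facts DECIDED IN THE KERNEL. (29,11) is OPEN IN PRINT ([BVY04 Thm 1.6] list;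
re-listed [RG24 = arXiv:2412.11933, Thm 4.38]); this is NOT “BVY improved by us”; `X¹¹ + Y¹¹ = z³` is NOT claimed (it is the CITED [DM97]); the
scope is Thm 1.6's cell exactly: pairwise coprime `x, y, z`, `|xy| > 1`, `α ≥ 1`, `n = 11` (C6).»
THE ROW. `sh04_29_11B : … → SH04Pair 29 11` through the generic row with REFINABLE allowed sets `bvy16K_pair` (`SH04/PairRowK.lean`; `p = 29 ≠ 3`,
`n = 11`, `p ≠ n`; `Aset = bvy04Allowed`, `Aref = krausAllowed29`). HYPOTHESES (the complete list — NO [Prop 4.3], NO rank input, NO L\*, NO CM table):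
* `hP : M.BVY04PackageA bvy04Allowed` — [H1 + H2 + H3 + H4 at the ordinary primes] = [BVY04, Lemma 3.4 + Cor 3.3 + Prop 4.2 (ν-wise)] AS
  AMENDED (two-signed `S_q`, `SH04/TwoSigned.lean`; WEAKER than print's one-signed package). CITED, named. Used for the EXISTENCE of the newform.
* `hK : M.BVY04AuxPrimeA bvy04Allowed 67` — [H4, complete and ideal-wise] the same congruences JOINTLY (one `ψ`) with the trace identity at the
  auxiliary prime 67: `ψ(c₆₇) = a₆₇(E)` if `67 ∤ xy`, `= ±68` if `67 ∣ xy` ([Sik08 Prop 5.1 (i)/(ii)] / [KO92]; `SH04/Kraus67.lean`). CITED, named.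
  From it + the KERNEL facts `krausAux67` (H6: every member of the reduced Frey family at 67 has trace in `T₆₇`) and `freyTraceAt67_mem`
  (`29^α, x¹¹, y¹¹ ∈ μ₆` put `E mod 67` in that family) this file DERIVES `PairCongruences 29 11 krausAllowed29` (`pairCongruences_kraus29`):
  the congruences on the REFINED sets — so the refinement at 67 is NOT a hypothesis.
* `hD87 : M.DataComplete 87 level87Orbits`, `hD261 : M.DataComplete 261 level261Orbits`, `hD783 : M.DataComplete 783 level783Orbits` — [H5]
  COMPUTED (certificate 4a36c28685fe0350 part C; the two entries `c₆₇(87.1) = c₆₇(261.3) = 10y − 7` from crit-1 PARI j326036, consistent with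
  eng-2 partC.rec l.1079 and inv-6's Ribet/174a1 prediction; generator `gen_2911.py`, HOME `run/shared/lean/pub/abc-shadow/typ-1/gen/`).
* `hDM : darmonMerel1997_sumOfPowersEqCube` — [DM97] for the sub-case `11 ∣ α` (then the equation is `x¹¹ + Y¹¹ = z³`). CITED.
KERNEL: the [Prop 4.2]+Kraus sieve at `n = 11` for ALL `2 + 5 + 10` orbits of `S₂^new(87 / 261 / 783)` by mod-11 PRIME-IDEAL TreeN certificates
(`decide +kernel`, level files): 87.1 / 261.3 die on the split `q = 31` (prime `(11, y − 4)`) then `q = 67` (prime `λ`; refined list), everything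
else at `q = 5`; `KrausAux67` (36 literal point counts over `𝔽₆₇²`) and the reduction of a datum into the family; the levels `3p / 9p / 27p`;
`p ∤ xz`, `α = 11k + e`, coprimality and print's normal form (generic row). Words: typed/kernel-checked REDUCTION modulo named hypotheses — never
«proved by us»; `Thm16With ∅` downstream is OUR CONDITIONAL READING, not «[BVY04 Thm 1.6] completed»; derived ≠ printed ≠ refereed; adjacent
(signature (n,n,3)), NOT abc — abc is NOT proved and nothing here is distance to abc; no side on IUT. AI-typed and AI-criticised; weaker than expert
refereeing of the cited inputs. TYPED — crit-1 faithfulness read pending (KEY acceptance (c)).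
-/

namespace Summit.Ventures.AbcShadow

open Summit.Ventures.AbcSig (NewformModel FreyDatum OrbitData)
open Literature.NumberTheory.DiophantineGeometry (darmonMerel1997_sumOfPowersEqCube)
open Literature.NumberTheory.DiophantineGeometry.BennettVatsalYazdani2004 (thm16Exceptional thm16Primes)

/-- Bookkeeping [cite: BennettVatsalYazdani2004, Thm 1.6 p.1400]: `29` is one of the primes of Theorem 1.6, the pair `(29, 11)` IS on print's
possibly-exceptional list, and it is NOT covered by the other printed escape clause "`n` divides `p² − 1`" (`29² − 1 = 840 = 11·76 + 4`), so
`SH04Pair 29 11` is exactly what print leaves open there. -/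
theorem sh04Pair29_11_listed : 29 ∈ thm16Primes ∧ (29, 11) ∈ thm16Exceptional ∧ ¬ (11 ∣ 29 ^ 2 - 1) := by
  refine ⟨by decide, by decide, by norm_num⟩

/-! ## The refinement at 67 DERIVED: `BVY04AuxPrimeA bvy04Allowed 67` + kernel ⇒ the congruences on `krausAllowed29` -/

/-- The [Cor 3.3] level of a datum of the pair `(29, 11)` is prime to `67` (`N = Rad*(29^e)·3^k = 29·3^k`). [cite: BennettVatsalYazdani2004, Cor 3.3 p.1405] -/
theorem bvy04Level_29_not_dvd67 (κ : BVYCase) {A B e : ℕ} (he : 1 ≤ e) (hAB : A * B = 29 ^ e) : ¬ 67 ∣ bvy04Level κ A B 1 := by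
  unfold bvy04Level
  rw [hAB, radStar_prime_pow 29 e (by norm_num) (by norm_num) (by omega), radStar_one, one_pow, mul_one]
  intro h
  rcases (Nat.Prime.dvd_mul (by norm_num : Nat.Prime 67)).mp h with h29 | h3
  · norm_num at h29
  · have := (Nat.prime_dvd_prime_iff_eq (by norm_num : Nat.Prime 67) Nat.prime_three).mp
      ((by norm_num : Nat.Prime 67).dvd_of_dvd_pow h3)
    norm_num at this

/-- **The Kraus refinement, derived (not assumed).** From the named print input `BVY04AuxPrimeA bvy04Allowed 67` (ONE `ψ` carrying the two-signed
[Prop 4.2] congruences at every odd `ℓ ∤ nN` AND the trace identity at 67) and the KERNEL facts of `SH04/KrausAux67.lean`: for every datum of the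
pair `(29, 11)` in print's normal form, every newform of the [Cor 3.3] level from which `ρ_{E,11}` arises carries the congruences on the REFINED
sets `krausAllowed29` — at `ℓ ≠ 67` this is clause (a); at `ℓ = 67`: if `67 ∣ ab` clause (c) gives `±68`, else clause (b) gives
`ψ(c₆₇) = a₆₇(E) ∈ T₆₇` by `freyTraceAt67_mem` (`29^α, a¹¹, b¹¹ ∈ μ₆` and `krausAux67`). IDEAL-WISE throughout (the same `ψ`).
[cite: Kraus1998, §1 (the auxiliary-prime refinement); Siksek2007ModularApproach, Prop 5.1 (i)/(ii) p.5-6; BennettVatsalYazdani2004, Prop 4.2 pp.1406-1407] -/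
theorem pairCongruences_kraus29 (M : CMNewformModel) (hK : M.BVY04AuxPrimeA bvy04Allowed 67) :
    M.PairCongruences 29 11 krausAllowed29 := by
  intro S κ e hC1 hSn he1 hen hAB hA hB hC hcf hpf hn h5 hnABC h3a h3b hsol hab1 hab2 hx1 hx2 hκ N hN f hf
  have h67ABC : ¬ 67 ∣ S.A * S.B * S.C := by
    rw [hAB, hC1, mul_one]
    intro h
    have := (Nat.prime_dvd_prime_iff_eq (by norm_num : Nat.Prime 67) (by norm_num : Nat.Prime 29)).mp
      ((by norm_num : Nat.Prime 67).dvd_of_dvd_pow h)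
    norm_num at this
  have h67N : ¬ 67 ∣ N := by
    rw [← hN, hC1]
    exact bvy04Level_29_not_dvd67 κ he1 hAB
  have h67n : (67 : ℕ) ≠ S.n := by rw [hSn]; norm_num
  obtain ⟨k, hk, hc, ψ, hall, hgood, hmult⟩ := hK S κ hA hB hC hcf hpf hn h5 hnABC h3a h3b hsol hab1 hab2 hx1 hx2 hκ
    (by norm_num) (by norm_num) (by norm_num) h67n h67ABC N hN h67N f hf
  refine ⟨k, hk, hc, ψ, fun ℓ hℓ h2 hℓn hℓN => ?_⟩
  by_cases h67 : ℓ = 67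
  · subst h67
    by_cases hab : (67 : ℤ) ∣ S.a * S.b
    · -- multiplicative reduction at 67: `ψ(c₆₇) = ±68`
      have h68 : ((((67 : ℕ) : ℤ) + 1 : ℤ) : k) = ((68 : ℤ) : k) := by norm_num
      have h68' : ((-(((67 : ℕ) : ℤ) + 1) : ℤ) : k) = ((-68 : ℤ) : k) := by norm_num
      rcases hmult hab with h | h
      · exact ⟨68, by decide, h.trans h68⟩
      · exact ⟨-68, by decide, h.trans h68'⟩
    · -- good reduction at 67: `ψ(c₆₇) = a₆₇(E) ∈ T₆₇`
      have ha : ¬ (67 : ℤ) ∣ S.a := fun h => hab (Dvd.dvd.mul_right h _)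
      have hb : ¬ (67 : ℤ) ∣ S.b := fun h => hab (Dvd.dvd.mul_left h _)
      have hmem : freyTraceAt 67 S ∈ krausTraces67 := by
        obtain ⟨A', B', C', n', a', b', c'⟩ := S
        simp only at hC1 hSn hAB hsol ha hb
        subst hC1 hSn
        exact freyTraceAt67_mem hAB (by simpa using hsol.1) ha hb
      exact ⟨freyTraceAt 67 S, krausTraces67_subset _ hmem, hgood hab⟩
  · obtain ⟨t, ht, h⟩ := hall ℓ hℓ h2 hℓn hℓN
    exact ⟨t, by rw [krausAllowed29_of_ne h67]; exact ht, h⟩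

/-- Level 783 on the refined sets: `krausAllowed29 ⊆ bvy04Allowed` pointwise and elimination is antitone in the allowed sets
(`OrbitData.Eliminated.anti` of the sister venture), so the two-signed certificates of `Level783.lean` serve. [cite: BennettVatsalYazdani2004, Prop 4.2 p.1406 (kernel certificate, two-signed)] -/
theorem level783_elim11K : ∀ o ∈ level783Orbits, o.Eliminated krausAllowed29 11 :=
  fun o ho => (level783_elim11 o ho).anti fun e _ t ht => krausAllowed29_subset e.ell t ht

/-- Monotonicity of the auxiliary-prime hypothesis in the allowed sets of clause (a) (larger sets = weaker hypothesis); in particular the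
instance on print's one-signed sets implies the one on the two-signed sets. [folklore] -/
theorem CMNewformModel.BVY04AuxPrimeA.mono {M : CMNewformModel} {A A' : ℕ → List ℤ} {q : ℕ} (hAA' : ∀ ℓ : ℕ, ∀ t ∈ A ℓ, t ∈ A' ℓ)
    (hK : M.BVY04AuxPrimeA A q) : M.BVY04AuxPrimeA A' q := by
  intro S κ hA hB hC hcf hpf hn h5 hnABC h3a h3b hsol hab1 hab2 he1 he2 hκ hq hq2 hq3 hqn hqABC N hN hqN f hf
  obtain ⟨k, hk, hc, ψ, hall, hgood, hmult⟩ :=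
    hK S κ hA hB hC hcf hpf hn h5 hnABC h3a h3b hsol hab1 hab2 he1 he2 hκ hq hq2 hq3 hqn hqABC N hN hqN f hf
  refine ⟨k, hk, hc, ψ, fun ℓ hℓ h2 hℓn hℓN => ?_, hgood, hmult⟩
  obtain ⟨t, ht, h⟩ := hall ℓ hℓ h2 hℓn hℓN
  exact ⟨t, hAA' ℓ t ht, h⟩

/-! ## The row -/

/-- **Row SH-04 `(29, 11)`, package AS AMENDED + Kraus prime 67, for `11 ∤ α`** (no Darmon–Merel input): under `BVY04PackageA bvy04Allowed`,
`BVY04AuxPrimeA bvy04Allowed 67` and the three COMPUTED `DataComplete` hypotheses, `x¹¹ + 29^α y¹¹ = z³` has no solution in pairwise coprime integers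
with `|xy| > 1` when `11 ∤ α`, `α ≥ 1`. CONDITIONAL STRIKE (module docstring). [cite: BennettVatsalYazdani2004, Thm 1.6 p.1400 (listed pair (29,11)); Lemma 3.4, Cor 3.3, Prop 4.2 (two-signed); Kraus1998, §1 (auxiliary prime 67)] -/
theorem sh04_29_11B_of_not_dvd (M : CMNewformModel) (hP : M.BVY04PackageA bvy04Allowed) (hK : M.BVY04AuxPrimeA bvy04Allowed 67)
    (hD87 : M.DataComplete 87 level87Orbits) (hD261 : M.DataComplete 261 level261Orbits)
    (hD783 : M.DataComplete 783 level783Orbits)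
    (α : ℕ) (hα : 0 < α) (h11 : ¬ 11 ∣ α) (x y z : ℤ) (hxy : IsCoprime x y) (hxz : IsCoprime x z) (hyz : IsCoprime y z)
    (hbig : 1 < |x * y|) (heq : x ^ 11 + (29 : ℤ) ^ α * y ^ 11 = z ^ 3) : False :=
  bvy16K_pair_of_not_dvd 29 11 (by norm_num) (by norm_num) (by norm_num) (by norm_num) (by norm_num) M bvy04Allowed krausAllowed29 hP
    (pairCongruences_kraus29 M hK) (by norm_num) (by norm_num) (by norm_num) level87Orbits level261Orbits level783Orbits
    level87_wellformed level261_wellformed level783_wellformed level87_elim11 level261_elim11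
    level783_elim11K
    hD87 hD261 hD783 α hα h11 x y z hxy hxz hyz hbig (by exact_mod_cast heq)

/-- **Row SH-04 `(29, 11)` — CONDITIONAL STRIKE (reduction theorem), package AS AMENDED (two-signed) + the Kraus auxiliary prime 67.** Under
`BVY04PackageA bvy04Allowed` (weaker than print's one-signed package), `BVY04AuxPrimeA bvy04Allowed 67` (the same congruences ideal-wise, jointly
with the trace identity at 67 [Sik08 Prop 5.1]), the COMPUTED `DataComplete` data of levels 87 / 261 / 783 and [DM97] for `11 ∣ α`:
`x¹¹ + 29^α y¹¹ = z³` has no solution in pairwise coprime integers with `|xy| > 1` for any `α ≥ 1` — `SH04Pair 29 11`, i.e. print's LISTED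
possible exception `(29, 11)` of [BVY04, Thm 1.6] is removed CONDITIONALLY on the named inputs (H1–H5 named, H6 decided in kernel). OPEN IN
PRINT; not "BVY improved by us"; ADJACENT, NOT abc. [cite: BennettVatsalYazdani2004, Thm 1.6 p.1400 (listed pair (29,11), conditionally on the named inputs, package as amended); Kraus1998, §1 (auxiliary prime q = 67); DarmonMerel1997, Main Thm (3) (11 ∣ α)] -/
theorem sh04_29_11B (M : CMNewformModel) (hP : M.BVY04PackageA bvy04Allowed) (hK : M.BVY04AuxPrimeA bvy04Allowed 67)
    (hD87 : M.DataComplete 87 level87Orbits) (hD261 : M.DataComplete 261 level261Orbits)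
    (hD783 : M.DataComplete 783 level783Orbits)
    (hDM : darmonMerel1997_sumOfPowersEqCube) : SH04Pair 29 11 :=
  bvy16K_pair 29 11 (by norm_num) (by norm_num) (by norm_num) (by norm_num) (by norm_num) M bvy04Allowed krausAllowed29 hP
    (pairCongruences_kraus29 M hK) (by norm_num) (by norm_num) (by norm_num) level87Orbits level261Orbits level783Orbits
    level87_wellformed level261_wellformed level783_wellformed level87_elim11 level261_elim11 level783_elim11K
    hD87 hD261 hD783 hDM

/-- **The same row from PRINT's one-signed sets** (pure logic: `BVY04Package → BVY04PackageA bvy04Allowed` and the auxiliary-prime hypothesis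
with clause (a) on print's `S_q` implies the one on the two-signed sets). [cite: BennettVatsalYazdani2004, Thm 1.6 p.1400 (conditionally)] -/
theorem sh04_29_11B_of_print (M : CMNewformModel) (hP : M.BVY04Package) (hK : M.BVY04AuxPrimeA bvy04AllowedPrint 67)
    (hD87 : M.DataComplete 87 level87Orbits) (hD261 : M.DataComplete 261 level261Orbits)
    (hD783 : M.DataComplete 783 level783Orbits)
    (hDM : darmonMerel1997_sumOfPowersEqCube) : SH04Pair 29 11 :=
  sh04_29_11B M (bvy04PackageB_of_print M hP) (hK.mono bvy04AllowedPrint_subset) hD87 hD261 hD783 hDM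

end Summit.Ventures.AbcShadow
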